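import Literature.Probability.RandomPlanarGeometry.KernelConvergence
import HarnessLib

/-!
# Crux `SAWDevelopingMap.ObservableToSLE` (stmt-CriticalPhenomena-10472), line `six-class-type-ladder`,
stub T2b′ `stub_carvedReduction_squeeze`: piece (G6′), CONTINUITY OF `Φ'_A(0)` UNDER KERNEL
CONVERGENCE IN COMPONENT FORM

Landing target:
`Summits/CriticalPhenomena/SAWScalingLimit/Theorems/SAWDevelopingMapObservableToSLETypeLadderCarvedReductionSqueezeKernel.lean`
(`--supports stmt-CriticalPhenomena-10472`; registered sub-goal `stub_carvedReduction_kernelComponent`).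

The outer side of the moving-carving squeeze compares the carved lattice domains with FIXED outer
Jordan hull subdomains `M⁺_n ↓` of a common super-domain `E`; in half-plane coordinates their
hulls `A_n ↑` increase inside the hull `A` of the limit carving.  The tree's continuity theorem
`HasRestrictionDeriv.tendsto_of_kernel_holds` (`Literature…KernelConvergence`) asks for the
kernel hypothesis `int ⋂ₙ (ℍ ∖ A_n) = ℍ ∖ A`, which FAILS as soon as the limit carving has
POCKETS (regions of the carved lattice domains pinched off in the limit: they lie in every
`ℍ ∖ A_n`, hence in the open kernel, but not in `ℍ ∖ A`).  The Carathéodory kernel theorem only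
ever sees the COMPONENT of the open kernel containing the base point, and so does the tree's
proof: the kernel hypothesis is used exactly once, to place the (open, connected) image of the
limit `Ψ*` of the inverse maps inside `ℍ ∖ A`.  This file proves the component form:

* `kernel_inverse_component` — the inverse-family step of `KernelConvergence` under the weaker
  hypothesis "every open preconnected `W ⊆ ⋂ₙ (ℍ ∖ A_n)` meeting `ℍ ∖ A` lies in `ℍ ∖ A`"
  (i.e. `ℍ ∖ A` is a union of components of the open kernel);
* `stub_carvedReduction_kernelComponent` — **`Φ'_{A_n}(0) → Φ'_A(0)`** for increasing `*`-hulls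
  `A_n ⊆ A` under that component-kernel hypothesis (registered sub-goal).

Sources: G. F. Lawler, O. Schramm, W. Werner, J. Amer. Math. Soc. 16 (2003), proof of Lemma 3.5;
Ch. Pommerenke, Boundary Behaviour of Conformal Maps (1992), Thm. 1.8 (kernel = component of the
base point).
-/

noncomputable section

open Set Filter Topology Metric Bornology Function Complex
open UpperHalfPlane (upperHalfPlaneSet isOpen_upperHalfPlaneSet)
open Literature.Probability.RandomPlanarGeometry

namespace Summit.CriticalPhenomena.SAWScalingLimit.Theorems.ObservableToSLE.TypeLadder

variable {A : Set ℂ} {An : ℕ → Set ℂ} {Φ : ConformalEquiv (upperHalfPlaneSet \ A) upperHalfPlaneSet}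
  {Φn : ∀ n, ConformalEquiv (upperHalfPlaneSet \ An n) upperHalfPlaneSet} {d : ℝ} {dn : ℕ → ℝ}

/-- **The inverse family under the component-kernel hypothesis** (adapted from
`Literature…KernelConvergence.kernel_inverse`): along a further subsequence `Φ_{φ ψ k}⁻¹ → Ψ*`
locally uniformly on `ℍ`, `Ψ* ∘ Φ* = id` on `U = ℍ ∖ A`, `Ψ*` injective, `im Ψ* ≥ im`, and
`Ψ*(ℍ) ⊆ U`: the image is open (open mapping), preconnected, misses every `A_m` (Hurwitz) and
contains `z₀ ∈ U`, so the component-kernel hypothesis applies. -/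
theorem kernel_inverse_component (hA : IsStarHull A) (hAn : ∀ n, IsStarHull (An n)) (hmono : Monotone An)
    (hsub : ∀ n, An n ⊆ A)
    (hker : ∀ W : Set ℂ, IsOpen W → IsPreconnected W → W ⊆ ⋂ n, upperHalfPlaneSet \ An n →
      (W ∩ (upperHalfPlaneSet \ A)).Nonempty → W ⊆ upperHalfPlaneSet \ A)
    (hΦn : ∀ n, IsRestrictionMap (An n) (Φn n)) {φ : ℕ → ℕ} (hφ : StrictMono φ) {Φs : ℂ → ℂ}
    (hΦsm : MapsTo Φs (upperHalfPlaneSet \ A) upperHalfPlaneSet)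
    (hΦslim : TendstoLocallyUniformlyOn (fun k ↦ (Φn (φ k) : ℂ → ℂ)) Φs atTop (upperHalfPlaneSet \ A))
    {z₀ : ℂ} (hz₀ : z₀ ∈ upperHalfPlaneSet \ A) :
    ∃ Ψs : ℂ → ℂ, DifferentiableOn ℂ Ψs upperHalfPlaneSet ∧ MapsTo Ψs upperHalfPlaneSet (upperHalfPlaneSet \ A) ∧
      (∀ z ∈ upperHalfPlaneSet \ A, Ψs (Φs z) = z) ∧ InjOn Ψs upperHalfPlaneSet ∧
      ∀ w ∈ upperHalfPlaneSet, w.im ≤ (Ψs w).im := by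
  set U := upperHalfPlaneSet \ A
  have hUo : IsOpen U := hA.1.isOpen_diff
  have hUn : ∀ k, U ⊆ upperHalfPlaneSet \ An (φ k) := fun k z hz ↦ ⟨hz.1, fun h ↦ hz.2 (hsub _ h)⟩
  -- the inverse family
  set F : ℕ → ℂ → ℂ := fun k ↦ ((Φn (φ k)).symm : ℂ → ℂ) with hF
  have hFd : ∀ k, DifferentiableOn ℂ (F k) upperHalfPlaneSet := fun k ↦ (Φn (φ k)).symm.differentiableOn_coe
  have hFm : ∀ k, MapsTo (F k) upperHalfPlaneSet upperHalfPlaneSet := fun k w hw ↦ ((Φn (φ k)).symm_mapsTo hw).1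
  have hzk : ∀ k, Φn (φ k) z₀ ∈ upperHalfPlaneSet := fun k ↦ (Φn (φ k)).mapsTo (hUn k hz₀)
  have hz₁ : Φs z₀ ∈ upperHalfPlaneSet := hΦsm hz₀
  have hFz : Tendsto (fun k ↦ F k (Φn (φ k) z₀)) atTop (𝓝 z₀) :=
    tendsto_const_nhds.congr fun k ↦ ((Φn (φ k)).symm_apply_apply (hUn k hz₀)).symm
  obtain ⟨ψ, Ψs, hψ, hΨsd, hΨsm, hΨlim⟩ := exists_subseq_tendstoLocallyUniformlyOn_of_mapsTo
    isOpen_upperHalfPlaneSet (convex_halfSpace_im_gt 0).isPreconnected hFd hFm hzk hz₁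
    (hΦslim.tendsto_at hz₀) hz₀.1 hFz
  -- `Ψ* ∘ Φ* = id` on `U`
  have hleft : ∀ z ∈ U, Ψs (Φs z) = z := by
    intro z hz
    have hg : Tendsto (fun k ↦ Φn (φ (ψ k)) z) atTop (𝓝[upperHalfPlaneSet] (Φs z)) :=
      tendsto_nhdsWithin_iff.2 ⟨(hΦslim.tendsto_at hz).comp hψ.tendsto_atTop,
        Eventually.of_forall fun k ↦ (Φn _).mapsTo (hUn _ hz)⟩
    have h1 := hΨlim.tendsto_comp (hΨsd.continuousOn.continuousWithinAt (hΦsm hz)) (hΦsm hz) hg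
    have h2 : Tendsto (fun k ↦ F (ψ k) (Φn (φ (ψ k)) z)) atTop (𝓝 z) :=
      tendsto_const_nhds.congr fun k ↦ ((Φn (φ (ψ k))).symm_apply_apply (hUn _ hz)).symm
    exact tendsto_nhds_unique h1 h2
  -- `im Ψ* ≥ im`
  have him : ∀ w ∈ upperHalfPlaneSet, w.im ≤ (Ψs w).im := by
    intro w hw
    refine ge_of_tendsto ((continuous_im.tendsto _).comp (hΨlim.tendsto_at hw)) (Eventually.of_forall fun k ↦ ?_)
    have hmem := (Φn (φ (ψ k))).symm_mapsTo hw
    have := (hΦn (φ (ψ k))).im_le_im (hAn _).1.1 hmem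
    rw [(Φn (φ (ψ k))).apply_symm_apply hw] at this
    exact this
  -- `Ψ*` is not constant, hence injective (Hurwitz)
  have hnc : ∀ c : ℂ, ¬ EqOn Ψs (fun _ ↦ c) upperHalfPlaneSet := by
    intro c hc
    obtain ⟨ε, hε, hball⟩ := Metric.isOpen_iff.1 hUo z₀ hz₀
    have hz' : z₀ + (ε / 2 : ℝ) ∈ U := hball (by
      rw [mem_ball, dist_eq_norm, add_sub_cancel_left, norm_real, Real.norm_of_nonneg (by positivity)]; linarith)
    have h1 : Ψs (Φs z₀) = z₀ := hleft z₀ hz₀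
    have h2 : Ψs (Φs (z₀ + (ε / 2 : ℝ))) = z₀ + (ε / 2 : ℝ) := hleft _ hz'
    rw [hc (hΦsm hz₀)] at h1
    rw [hc (hΦsm hz'), h1] at h2
    have : ((ε / 2 : ℝ) : ℂ) = 0 := by
      have := congrArg (· - z₀) h2; simpa using this.symm
    rw [ofReal_eq_zero] at this
    linarith
  have hinj : InjOn Ψs upperHalfPlaneSet := by
    have hF' : ∀ᶠ k in atTop, DifferentiableOn ℂ (F (ψ k)) upperHalfPlaneSet := Eventually.of_forall fun k ↦ hFd _
    have hinj' : ∀ᶠ k in atTop, InjOn (F (ψ k)) upperHalfPlaneSet := Eventually.of_forall fun k ↦ (Φn _).symm.injOn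
    rcases Complex.exists_eqOn_const_or_injOn_of_tendstoLocallyUniformlyOn isOpen_upperHalfPlaneSet
      (convex_halfSpace_im_gt 0).isPreconnected hF' hinj' hΨlim with ⟨c, hc⟩ | h
    · exact absurd hc (hnc c)
    · exact h
  -- `Ψ*(ℍ)` misses every `A_m` (Hurwitz)
  have hmiss : ∀ w ∈ upperHalfPlaneSet, ∀ m, Ψs w ∉ An m := by
    intro w hw m hζ
    set ζ := Ψs w
    have hlim' : TendstoLocallyUniformlyOn (fun k v ↦ F (ψ k) v - ζ) (fun v ↦ Ψs v - ζ) atTop upperHalfPlaneSet :=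
      tendstoLocallyUniformlyOn_sub_const hΨlim ζ
    have hF' : ∀ᶠ k in atTop, DifferentiableOn ℂ (fun v ↦ F (ψ k) v - ζ) upperHalfPlaneSet :=
      Eventually.of_forall fun k ↦ (hFd _).sub_const ζ
    have h0 : ∃ᶠ k in atTop, ∀ v ∈ upperHalfPlaneSet, F (ψ k) v - ζ ≠ 0 := by
      refine Eventually.frequently ?_
      have hev : ∀ᶠ k in atTop, m ≤ φ (ψ k) := (hφ.comp hψ).tendsto_atTop.eventually (eventually_ge_atTop m)
      filter_upwards [hev] with k hk v hv h0
      have hmem := (Φn (φ (ψ k))).symm_mapsTo hv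
      rw [sub_eq_zero] at h0
      have := hmono hk hζ
      rw [← h0] at this
      exact hmem.2 this
    rcases hurwitz_eqOn_zero_or_forall_ne_zero isOpen_upperHalfPlaneSet (convex_halfSpace_im_gt 0).isPreconnected
      hF' hlim' h0 with h | h
    · refine hnc ζ fun v hv ↦ ?_
      have := h hv; simpa [sub_eq_zero] using this
    · exact h w hw (sub_self _)
  have hopen : IsOpen (Ψs '' upperHalfPlaneSet) := by
    rcases (hΨsd.analyticOnNhd isOpen_upperHalfPlaneSet).is_constant_or_isOpen
      (convex_halfSpace_im_gt 0).isPreconnected with ⟨c, hc⟩ | h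
    · exact absurd (fun w hw ↦ hc w hw) (hnc c)
    · exact h _ subset_rfl isOpen_upperHalfPlaneSet
  -- THE COMPONENT KERNEL: `Ψ*(ℍ)` is open, preconnected, inside `⋂ (ℍ ∖ A_m)`, and contains `z₀ ∈ U`
  have hpre : IsPreconnected (Ψs '' upperHalfPlaneSet) :=
    (convex_halfSpace_im_gt 0).isPreconnected.image _ hΨsd.continuousOn
  have hinter : Ψs '' upperHalfPlaneSet ⊆ ⋂ m, upperHalfPlaneSet \ An m := by
    rintro _ ⟨w, hw, rfl⟩
    exact mem_iInter.2 fun m ↦ ⟨lt_of_lt_of_le hw (him w hw), hmiss w hw m⟩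
  have hmeet : (Ψs '' upperHalfPlaneSet ∩ U).Nonempty :=
    ⟨z₀, ⟨Φs z₀, hz₁, hleft z₀ hz₀⟩, hz₀⟩
  have hsubset : Ψs '' upperHalfPlaneSet ⊆ U := hker _ hopen hpre hinter hmeet
  exact ⟨Ψs, hΨsd, fun w hw ↦ hsubset ⟨w, hw, rfl⟩, hleft, hinj, him⟩

/-- **Registered sub-goal `stub_carvedReduction_kernelComponent`** (crux item stmt-CriticalPhenomena-10472,
stub T2b′ `stub_carvedReduction_squeeze`, piece (G6′) KERNEL CONTINUITY, COMPONENT FORM): for `*`-hulls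
`A_n ↑`, `A_n ⊆ A`, such that `ℍ ∖ A` is a union of components of the open kernel of `ℍ ∖ A_n`
(every open preconnected `W ⊆ ⋂ₙ (ℍ ∖ A_n)` meeting `ℍ ∖ A` lies in it — pockets allowed),
`Φ'_{A_n}(0) → Φ'_A(0)`.  Generalises `HasRestrictionDeriv.tendsto_of_kernel_holds` (whose kernel
hypothesis `int ⋂ₙ (ℍ ∖ A_n) = ℍ ∖ A` implies this one); same proof (Montel, Hurwitz, Schwarz
reflection near `0`, normal form of `Aut ℍ`), with the inverse-family step replaced by
`kernel_inverse_component`.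
[cite: LawlerSchrammWerner2003Restriction, proof of Lemma 3.5 (p. 12)] -/
theorem stub_carvedReduction_kernelComponent :
    ∀ (A : Set ℂ) (An : ℕ → Set ℂ) (Φ : ConformalEquiv (upperHalfPlaneSet \ A) upperHalfPlaneSet)
      (Φn : ∀ n, ConformalEquiv (upperHalfPlaneSet \ An n) upperHalfPlaneSet) (d : ℝ) (dn : ℕ → ℝ),
      IsStarHull A → (∀ n, IsStarHull (An n)) → Monotone An → (∀ n, An n ⊆ A) →
      (∀ W : Set ℂ, IsOpen W → IsPreconnected W → W ⊆ ⋂ n, upperHalfPlaneSet \ An n →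
        (W ∩ (upperHalfPlaneSet \ A)).Nonempty → W ⊆ upperHalfPlaneSet \ A) →
      IsRestrictionMap A Φ → HasRestrictionDeriv A Φ d →
      (∀ n, IsRestrictionMap (An n) (Φn n)) → (∀ n, HasRestrictionDeriv (An n) (Φn n) (dn n)) →
      Tendsto dn atTop (𝓝 d) := by
  intro A An Φ Φn d dn hA hAn hmono hsub hker hΦ hd hΦn hdn
  obtain ⟨dstar, hdlim, hdd, -, hdpos, -, -⟩ :=
    exists_tendsto_restrictionDeriv_of_monotone hA hAn hmono hsub hΦ hd hΦn hdn
  have hdspos : 0 < dstar := hdpos.trans_le hdd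
  obtain ⟨r, hr0, hr⟩ := hA.exists_disjoint_ball
  obtain ⟨φ, Φs, Gs, hφ, hGsd, hGs0, hGs', hΦsd, hΦsm, hΦslim, hEq⟩ :=
    kernel_extraction hA hAn hsub hΦn hdn hdlim hdspos hr0 hr
  obtain ⟨hinj, -⟩ := kernel_injOn (Φn := Φn) hA hsub hr0 hr hGsd hGs' hdspos hΦslim hEq
  -- a point of `U`
  have hz₀ : I * ((r / 2 : ℝ) : ℂ) ∈ upperHalfPlaneSet \ A := by
    refine inter_ball_subset_diff hr ⟨show 0 < (I * ((r / 2 : ℝ) : ℂ)).im by simp [hr0], ?_⟩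
    rw [mem_ball_zero_iff, norm_mul, norm_I, one_mul, norm_real, Real.norm_of_nonneg (by positivity)]
    linarith
  obtain ⟨Ψs, hΨsd, hΨsm, hleft, hΨinj, hΨim⟩ :=
    kernel_inverse_component hA hAn hmono hsub hker hΦn hφ hΦsm hΦslim hz₀
  have him : ∀ z ∈ upperHalfPlaneSet \ A, (Φs z).im ≤ z.im := fun z hz ↦
    le_of_tendsto ((continuous_im.tendsto _).comp (hΦslim.tendsto_at hz)) (Eventually.of_forall fun k ↦
      (hΦn (φ k)).im_le_im (hAn _).1.1 ⟨hz.1, fun h ↦ hz.2 (hsub _ h)⟩)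
  have := kernel_identification hA hΦ hd hr0 hr hGsd hGs0 hGs' hdd hΦsd hΦsm hinj hEq him hΨsd hΨsm hleft hΨinj hΨim
  rw [← this]; exact hdlim

/-- The tree's kernel hypothesis `int ⋂ₙ (ℍ ∖ A_n) = ℍ ∖ A` implies the component-kernel
hypothesis (an open subset of the intersection lies in its interior). -/
theorem componentKernel_of_interior_eq
    (hker : interior (⋂ n, upperHalfPlaneSet \ An n) = upperHalfPlaneSet \ A) :
    ∀ W : Set ℂ, IsOpen W → IsPreconnected W → W ⊆ ⋂ n, upperHalfPlaneSet \ An n →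
      (W ∩ (upperHalfPlaneSet \ A)).Nonempty → W ⊆ upperHalfPlaneSet \ A := by
  intro W hWo _ hWsub _
  rw [← hker]
  exact interior_maximal hWsub hWo

end Summit.CriticalPhenomena.SAWScalingLimit.Theorems.ObservableToSLE.TypeLadder

end
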